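import Summits.AtomisticToContinuum.Crystallization.Theses.NashClassCertificates
import Summits.AtomisticToContinuum.Crystallization.Theorems.PricedLinkCensusStackingHingeEStarStrict
import Summits.AtomisticToContinuum.Crystallization.Theorems.CoerciveTwoShellGap.Negative.Tolerance

/-!
# Crux `NashTwoShellGap` (stmt-AtomisticToContinuum-16826), line `bulk_dilute`: the FINITE CORNER —
# for every fixed number of particles the crux inequality holds with some positive price

For each `N ≥ 1` the Lennard-Jones ground-state energy is STRICTLY above the bulk floor,
`N·e* < E(N)` (no finite cluster is a bulk minimiser: tree theorem
`PricedHcpWindowsEStarStrict.stub_eStarStrict` applied to a ground state, which exists by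
`LennardJonesGroundStatesExist_holds`).  Since `#bad ≤ N` and `E(N) ≤ 𝓔(x)` for every injective `x`,
the price `g_N := (E(N) − N·e*)/N > 0` charges every bad particle of every `N`-particle configuration,
and `min_{N ≤ N₀} g_N` works up to `N₀` (registered sub-goal `stub_finiteCorner`; no Nash and no
separation hypothesis is needed — injectivity only).  Reading: all content of the crux (and of both gap
stubs of line `bulk_dilute`) is the UNIFORMITY of the price in `N`; no single configuration can witness
`¬ NashTwoShellGap`, only sequences with `(𝓔 − N e*)/#bad → 0` can (cf. the disprover's
`violation_squeeze`).  No definitions; all `[folklore]`.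
-/

noncomputable section

namespace Summit.AtomisticToContinuum.Crystallization.Theorems.NashTwoShellGapFiniteCorner

open scoped BigOperators Classical
open Literature.MathematicalPhysics.StatisticalMechanics Literature.Geometry.DiscreteGeometry
open Summit.AtomisticToContinuum.Crystallization.Theorems.ChargedEnergyGapNegative

/-- **`N·e* < E(N)` for `N ≥ 1`**: the strict floor at a ground state. [folklore] -/
theorem card_mul_eStar_lt_groundStateEnergy {N : ℕ} (hN : 0 < N) :
    (N : ℝ) * eStar < groundStateEnergy lennardJones 3 N := by
  obtain ⟨x, hx⟩ := LennardJonesGroundStatesExist_holds N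
  rw [← hx.2]
  exact PricedHcpWindowsEStarStrict.stub_eStarStrict N x hN hx.1

/-- **The per-`N` price**: for `N ≥ 1` there is `g > 0` with `N·e* + g·#bad ≤ 𝓔(x)` for every injective
`x : Fin N → ℝ³` (take `g := (E(N) − N e*)/N`, use `#bad ≤ N` and `E(N) ≤ 𝓔(x)`). [folklore] -/
theorem exists_price_fixed_card {N : ℕ} (hN : 0 < N) :
    ∃ g : ℝ, 0 < g ∧ ∀ x : Fin N → E3, Function.Injective x →
      (N : ℝ) * eStar + g * (Nat.card {i : Fin N // ¬ IsTwoShellGood (1 / 20) (47 / 50) 1 x i} : ℝ)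
        ≤ interactionEnergy lennardJones x := by
  have hNr : (0 : ℝ) < N := by exact_mod_cast hN
  set δ : ℝ := groundStateEnergy lennardJones 3 N - (N : ℝ) * eStar with hδ
  have hδpos : 0 < δ := by
    have := card_mul_eStar_lt_groundStateEnergy hN
    linarith
  refine ⟨δ / N, div_pos hδpos hNr, fun x hx => ?_⟩
  have hE : groundStateEnergy lennardJones 3 N ≤ interactionEnergy lennardJones x :=
    groundStateEnergy_lennardJones_le hx
  have hB : (Nat.card {i : Fin N // ¬ IsTwoShellGood (1 / 20) (47 / 50) 1 x i} : ℝ) ≤ N := by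
    exact_mod_cast CoerciveTwoShellGapNegative.bad_le (1 / 20) x
  have hB0 : (0 : ℝ) ≤ (Nat.card {i : Fin N // ¬ IsTwoShellGood (1 / 20) (47 / 50) 1 x i} : ℝ) :=
    Nat.cast_nonneg _
  have h1 : δ / N * (Nat.card {i : Fin N // ¬ IsTwoShellGood (1 / 20) (47 / 50) 1 x i} : ℝ) ≤ δ / N * N :=
    mul_le_mul_of_nonneg_left hB (div_pos hδpos hNr).le
  rw [div_mul_cancel₀ _ hNr.ne'] at h1
  linarith

/-- **Registered sub-goal `stub_finiteCorner`** — the finite corner of the crux: for every `N₀` one price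
`g > 0` charges every `1/20`-bad particle of every injective configuration of at most `N₀` points,
`N·e* + g·#bad ≤ 𝓔_LJ(x)` (induction on `N₀`, taking minima of the per-`N` prices). [folklore] -/
theorem stub_finiteCorner : ∀ N₀ : ℕ, ∃ g : ℝ, 0 < g ∧ ∀ (N : ℕ) (x : Fin N → EuclideanSpace ℝ (Fin 3)), N ≤ N₀ → Function.Injective x → (N : ℝ) * (⨅ Q : Literature.MathematicalPhysics.StatisticalMechanics.PeriodicConfiguration 3, Q.energyPerParticle Literature.MathematicalPhysics.StatisticalMechanics.lennardJones) + g * (Nat.card {i : Fin N // ¬ Literature.Geometry.DiscreteGeometry.IsTwoShellGood (1 / 20) (47 / 50) 1 x i} : ℝ) ≤ Literature.MathematicalPhysics.StatisticalMechanics.interactionEnergy Literature.MathematicalPhysics.StatisticalMechanics.lennardJones x := by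
  intro N₀
  induction N₀ with
  | zero =>
    refine ⟨1, one_pos, fun N x hN _ => ?_⟩
    obtain rfl : N = 0 := Nat.le_zero.1 hN
    have hB : (Nat.card {i : Fin 0 // ¬ IsTwoShellGood (1 / 20) (47 / 50) 1 x i} : ℝ) = 0 := by
      have := CoerciveTwoShellGapNegative.bad_le (1 / 20) x
      exact_mod_cast Nat.le_zero.1 this
    rw [hB, interactionEnergy_of_subsingleton]
    simp
  | succ n ih =>
    obtain ⟨g, hg, hG⟩ := ih
    obtain ⟨g', hg', hG'⟩ := exists_price_fixed_card (Nat.succ_pos n)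
    refine ⟨min g g', lt_min hg hg', fun N x hN hx => ?_⟩
    have hB0 : (0 : ℝ) ≤ (Nat.card {i : Fin N // ¬ IsTwoShellGood (1 / 20) (47 / 50) 1 x i} : ℝ) :=
      Nat.cast_nonneg _
    rcases Nat.lt_or_ge N (n + 1) with hlt | hge
    · have h1 := hG N x (Nat.lt_succ_iff.1 hlt) hx
      have h2 : min g g' * (Nat.card {i : Fin N // ¬ IsTwoShellGood (1 / 20) (47 / 50) 1 x i} : ℝ) ≤
          g * (Nat.card {i : Fin N // ¬ IsTwoShellGood (1 / 20) (47 / 50) 1 x i} : ℝ) :=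
        mul_le_mul_of_nonneg_right (min_le_left g g') hB0
      have h1' : (N : ℝ) * eStar + g * (Nat.card {i : Fin N // ¬ IsTwoShellGood (1 / 20) (47 / 50) 1 x i} : ℝ) ≤
          interactionEnergy lennardJones x := h1
      show (N : ℝ) * eStar + _ ≤ _
      linarith
    · obtain rfl : N = n + 1 := le_antisymm hN hge
      have h1 := hG' x hx
      have h2 : min g g' * (Nat.card {i : Fin (n + 1) // ¬ IsTwoShellGood (1 / 20) (47 / 50) 1 x i} : ℝ) ≤
          g' * (Nat.card {i : Fin (n + 1) // ¬ IsTwoShellGood (1 / 20) (47 / 50) 1 x i} : ℝ) :=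
        mul_le_mul_of_nonneg_right (min_le_right g g') hB0
      show ((n + 1 : ℕ) : ℝ) * eStar + _ ≤ _
      linarith

end Summit.AtomisticToContinuum.Crystallization.Theorems.NashTwoShellGapFiniteCorner

end
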